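import Literature.MathematicalPhysics.QuantumFieldTheory.Balaban1983to89.B8Ineq130
import Literature.MathematicalPhysics.QuantumFieldTheory.Balaban1983to89.B7AvgGaugeCovariance

/-!
# `Balaban1983to89.B8Eq115GaugeFixing` — B8 (1.15)/(1.14): EXISTENCE AND UNIQUENESS of the block axial gauge with
# the global axial gauge of `Ūᵏ` on top, on the `ℤ^d` tower of averages (43); hence (1.130) for every orbit

T. Bałaban, *Spaces of regular gauge field configurations on a lattice and gauge fixing conditions*, Commun.
Math. Phys. **99** (1985) 75–102 `[Balaban1985RegularSpaces]` ("B8"), Sect. B p. 78 and Sect. F p. 98; it uses the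
gauge covariance (45) p. 24 of the average (42) of T. Bałaban, *Averaging operations for lattice gauge theories*,
Commun. Math. Phys. **98** (1985) 17–51 `[Balaban1985Averaging]` ("B7", "[3]" in B8).  STATUS: a published,
refereed paper; this file REPRODUCES a printed-but-unproved step ("It is easy to see that …") by an explicit
construction and kernel proof from the tree's certified forms; nothing here is new mathematics and nothing here is
a claim about the Clay problem.

## THE PRINTED TEXT (quoted from the page images)

* p. 78: "Because `(Ū^{u j})_b = (Ūʲ)ᵘ_b = u(b₋)(Ūʲ)_b u⁻¹(b₊)` for `b ⊂ T^{(j)}`, hence the set `𝔅_k(𝔅_k, V)` is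
  invariant with respect to gauge transformations `u` satisfying the conditions `u(y) = 1` for `y ∈ 𝔅_k`. (1.14)"
* p. 78: "Generally speaking a gauge condition is a surface in a space of gauge field configurations,
  intersecting each orbit at exactly one point. … There are many gauge conditions. An axial gauge is defined by
  the equations for `x_j ∈ Λ_j`, `j = 1, …, k`, we put `Ū^{j−1}(Γ_{x_j,x_{j−1}}) = 1` for `x_{j−1} ∈ B(x_j)`,
  `Ū^{j−2}(Γ_{x_{j−1},x_{j−2}}) = 1` for `x_{j−2} ∈ B(x_{j−1})`, …, `Ū(Γ_{x₂,x₁}) = 1` for `x₁ ∈ B(x₂)`,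
  `U(Γ_{x₁,x}) = 1` for `x ∈ B(x₁)`. (1.15)  It is easy to see that these equations together with (1.14) for gauge
  transformations determine uniquely an element in each orbit."
* p. 98: "We apply a gauge transformation to `U₀`, such that the gauge transformed configuration `U₀′` satisfies
  the axial gauge conditions (1.15), and `Ū₀′ᵏ` satisfies the global axial gauge conditions on `□̃^{(k)}` of the
  type introduced in the proof of Proposition 1 in [3], i.e. `Ū₀′ᵏ(Γ_{y,x}) = 1` for `x ∈ □̃^{(k)}`, where `y` is a
  center of `□̃^{(k)}`."
* [3] p. 24 (45) (the gauge covariance of the average (42), `\bar{V^u}_c = u(c₋) V̄_c u(c₊)⁻¹`) is the tree's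
  `B7Prop1Explicit.bavg_gaugeAct` (inside the analyticity domain of `log`); [3] p. 24 "the gauge transformed
  configuration `V₀ = V^{v₀}` satisfies the conditions `V₀(Γ_{y,x}) = 1`" is the tree's `axialFn` /
  `hol_axial_treeWord`.

## WHAT IS CERTIFIED HERE (kernel, axioms `propext`/`Classical.choice`/`Quot.sound` only)

On the `ℤ^d` carriers of `B7Prop1Explicit`/`B7Prop2Explicit` (`Ūʲ = avgIter L U j`), for bond fields valued in
an `AvgClosed` gauge group `G ≤ {|u| ≤ 1, |u⁻¹| ≤ 1}` (e.g. `U(N)`, `SU(N)`):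
* `tg` / `towerGauge` — THE EXPLICIT GAUGE TRANSFORMATION: on the top lattice `u_k := (Ūᵏ)(Γ_{y,·})` (the axial
  gauge of [3] p. 24 based at `y`), and downwards `u_j(x) := u_{j+1}(z)·Ūʲ(Γ_{Lz,x})` for `x ∈ B(Lz)` (depth
  recursion `tg`; the fine-lattice transformation is `towerGauge L U k y = tg … k`); `tg_succ_smul`,
  `tg_add_pow_smul` (consistency `u_j(Lz) = u_{j+1}(z)`);
* USED BY NAME from the tree's `B7AvgGaugeCovariance`: p. 78 "`(Ū^{u j})_b = (Ūʲ)ᵘ_b = u(b₋)(Ūʲ)_b u⁻¹(b₊)`" =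
  (11)/(45) of [3] for the `j`-fold average (43) (`avgIter_gaugeAct`: `\overline{(U^u)}^j = (Ūʲ)^{u∘(Lʲ·)}` under
  (1.7) with the Prop. 1/2 smallness of [3], the `log` of (43) inside its domain) and the gauge invariance of (1.7)
  (`pdev_gaugeAct`); added here only `pdevOn_gaugeAct` (the same on the plaquettes of a box);
* `h15_of_cov`, `top_of_cov`, **`gaugeFix_global`** — EXISTENCE: for every `G`-valued `U` with (1.7)
  (`sup_p |U(∂p) − 1| < α₀L²·L^{−2k}`) the configuration `U′ := U^{u}`, `u = towerGauge L U k y` (`G`-valued), is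
  `G`-valued, has the same plaquette deviations, satisfies (1.15) between ALL consecutive levels `Ū′^{j+1} → Ū′ʲ`
  at every block of `ℤ^d`, and `Ū′ᵏ(Γ_{y,z}) = 1` for every `z` (global axial gauge of the top level at `y`);
* `const_of_cov`, **`gaugeFix_unique`**, `gaugeFix_const_mul`, **`gaugeFix_unique_normalised`** — UNIQUENESS:
  two `G`-valued gauge transformations `u₁, u₂` of such a `U` both producing (1.15) at all levels and the global
  axial gauge of the top level at `y` differ by a CONSTANT, `u₂(x) = c·u₁(x)`, `c = u₂(Lᵏy)u₁(Lᵏy)⁻¹`, and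
  conversely constants act on the solutions; `towerGauge` is normalised by `u(Lᵏy) = 1` (`towerGauge_top`, print's
  (1.14) at the top center) and is THE UNIQUE normalised solution (`gaugeFix_unique_normalised`) — print's "these
  equations together with (1.14) … determine uniquely an element in each orbit";
* **`ineq130_global_fixed`**, **`ineq130_fixed`** — (1.130) (+ (1.128)) FOR EVERY ORBIT: the tree's
  `B8Ineq130.ineq130_global` / `B8Ineq130.ineq130` with their hypotheses (1.15) and global-axial-gauge DISCHARGED by
  the construction — for every `G`-valued `U₀` with (1.7) on `Ω_{k−1}` (global form), resp. on the unit plaquettes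
  of the cube `□̃` only (`pdevOn`, the gauge transformation then built from the clamped extension
  `B7Prop1Local.clampCfg` of `U₀|□̃`, `localGauge`), the gauge-fixed `U₀′ = U₀^{u}` obeys `|Ū₀′^{k−n}_b − 1| ≤
  8d²L²(Σ_{m<n}L^{−2m})α₀ + (M + 4R₁M₁)dL²α₀ < 11d²L²α₀ + 5dL²Mα₀ < 6dL²Mα₀` on every bond `b ⊂ □̃^{(k−n)}`.
This discharges HONEST SCOPE (i) of `B8Ineq130` (reconstruction packet GAPS C-B8-43 (i)).

## DICTIONARY (print ↦ this file)

As in `B8Ineq130` (levels `ℤ^d`, depth `n = k − j`, `□̃^{(j)} = [tlo n, thi n]`, (1.7) ↦ `pdev`/`pdevOn` bound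
`α₀L²(L^{−k})²`, (1.15) ↦ `axialFn (Ū^{j}) (L•z) (L•z + boxVec L r) = 1`, global axial gauge ↦ `hol (Ūᵏ) y
(treeWord (z − y)) = 1`); in addition: gauge transformation `u` on `T_η` ↦ `u : Site d → G` on the finest level,
its trace on the `j`-lattice ↦ `B7AvgGaugeCovariance.uLev L u j = u ∘ (Lʲ•·)` (`x_j ∈ Λ_j ⊂ L^jηℤ^d` ↦ `Lʲ•z`,
`z ∈ ℤ^d`); `U^{u}` ↦ `B7Prop1Explicit.gaugeAct u U` ((8) of [3]); "each orbit" ↦ `{gaugeAct u U : u G-valued}`.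

## HONEST SCOPE (what is NOT certified here)

(i) Torus / finite-volume aspects: print's gauge conditions live on `T_η` with the sets `Λ_j`, `𝔅_k` of (1.12) and
the normalisation (1.14) `u = 1` on `𝔅_k`; here the tower is the whole `ℤ^d` at every level and the TOP condition
is the one Sect. F actually uses (p. 98: the global axial gauge of `Ū₀′ᵏ` at the center `y`), not (1.14)/(1.16).
(ii) Accordingly print's normalisation (1.14) (`u = 1` on all of `𝔅_k`) is represented by the single condition
`u(Lᵏy) = 1` at the fine site under the top center: with it uniqueness is exact (`gaugeFix_unique_normalised`),
without it uniqueness holds modulo the constants, which do act (`gaugeFix_unique`, `gaugeFix_const_mul`).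
(iii) The covariance p. 78 "`(Ū^{uj})_b = (Ūʲ)ᵘ_b`" is the tree's `B7AvgGaugeCovariance.avgIter_gaugeAct`,
certified INSIDE the analyticity domain of the `log` in (43) (print's (43) is only defined there; DIVERGENCE (a) of
that module), i.e. under (1.7) with the explicit Prop. 1/2 smallness `C₀α₀L² ≤ ⅓`, `2α₀L² ≤ c₂′` of
`B7Prop2Explicit` — print: "`α₀` is so small that … all the theorems on averaging operations are valid"; all
existence/uniqueness statements here carry these hypotheses.  (iv) For the LOCAL carrier ((1.7) on `□̃` only) the
gauge transformation is built from the clamped extension of `U₀|□̃`; that its values at the sites of `□̃` depend on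
`U₀|□̃` alone is not asserted (it is not needed for (1.130)).  (v) `≤`/`<` and the explicit constants exactly as in
`B8Ineq130` (HONEST SCOPE (iii)–(v) there).

RELATED TREE WORK (cross-lineage, NOT re-used — different carriers and a different coarse-graining):
`T4MultilevelCombGauge` (`multiComb`, `eq_rooted_of_treeRel`: a multilevel block-wise RELATIVE comb gauge with free
root values and uniqueness given the roots, for the STRAIGHT coarse transports `scaled L U` on the `T4RelativeComb`
carriers); the present file treats the AVERAGED tower (43) `avgIter` of [3] (levels related by (11)/(45) only inside
the `log`-domain) in the absolute axial form (1.15) consumed by `B8Ineq130`.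

SECOND ENGINE (floating point, independent code path): `code/b2b-balaban-b08/g19/ineq130_check.py` of the
reconstruction packet constructs exactly this `u` numerically for random `SU(2)` towers (`d = 2, 3`, `L = 2, 3`,
`k = 2, 3`; `u_k(y) = 1` by construction) and checks (1.15), the top axial gauge and the covariance of (43) to
`1e-15` (its checks G1, G2).
-/

noncomputable section

open scoped BigOperators
open NormedSpace Finset

namespace Literature.MathematicalPhysics.QuantumFieldTheory.Balaban1983to89.B8Eq115GaugeFixing

open B7Prop1Explicit B7Prop2Explicit B7Prop1Local MatrixLog B8Lemma1NonAbelian B8Ineq129 B8Ineq130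
open B7AvgGaugeCovariance
open B8Lemma1Lattice (InBlock)

-- `Site` alone would resolve to the torus sites of `Setup.lean`; re-export the `ℤ^d` sites of `B7Prop1Explicit`.
export B7Prop1Explicit (Site)

variable {d : ℕ}

/-! ## §1 Blocks: the coarse site `fl L x` below `x` -/

/-- `fl L x` is THE `z` with `x ∈ B(Lz)`. [folklore] -/
theorem fl_eq_of_inBlock {L : ℕ} (hL : 1 ≤ L) {z x : Site d} (h : InBlock L ((L : ℤ) • z) x) : fl L x = z := by
  funext i
  have hL0 : (0 : ℤ) ≤ L := by positivity
  have h1 := h i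
  have h2 := inBlock_fl hL x i
  simp only [Pi.smul_apply, smul_eq_mul] at h1 h2
  obtain ⟨h1a, h1b⟩ := h1
  obtain ⟨h2a, h2b⟩ := h2
  have h3 : (L : ℤ) * fl L x i < (L : ℤ) * (z i + 1) := by linarith
  have h4 : (L : ℤ) * z i < (L : ℤ) * (fl L x i + 1) := by linarith
  have h5 := lt_of_mul_lt_mul_left h3 hL0
  have h6 := lt_of_mul_lt_mul_left h4 hL0
  omega

/-- `fl L (Lz) = z`. [folklore] -/
theorem fl_smul {L : ℕ} (hL : 1 ≤ L) (z : Site d) : fl L ((L : ℤ) • z) = z :=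
  fl_eq_of_inBlock hL fun i => by
    have : (0 : ℤ) < L := by exact_mod_cast hL
    simp only [Pi.smul_apply, smul_eq_mul]
    constructor <;> linarith

/-- `fl L (Lz + r) = z` for `r ∈ [0, L)^d`. [folklore] -/
theorem fl_block {L : ℕ} (hL : 1 ≤ L) (z : Site d) (r : Fin d → Fin L) :
    fl L ((L : ℤ) • z + boxVec L r) = z :=
  fl_eq_of_inBlock hL ((inBlock_iff L _ _).mpr ⟨r, rfl⟩)

/-- Every site is `Lz + r` with `z = fl L x`, `r ∈ [0, L)^d` (the block decomposition of `ℤ^d`). [folklore] -/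
theorem exists_block {L : ℕ} (hL : 1 ≤ L) (x : Site d) :
    ∃ r : Fin d → Fin L, x = (L : ℤ) • fl L x + boxVec L r :=
  (inBlock_iff L _ _).mp (inBlock_fl hL x)

/-! ## §2 Gauge transformations (8), the tower gauge transformation, and the algebra of (1.15) -/

section Algebra

variable {G : Type*} [Group G]

/-- Composition of gauge transformations: `V^{wu} = (V^{u})^{w}`. [cite: Balaban1985Averaging, (8) p.18] -/
theorem gaugeAct_mul (w u : Site d → G) (V : Site d → Fin d → G) :
    gaugeAct (w * u) V = gaugeAct w (gaugeAct u V) := by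
  funext x μ
  simp only [gaugeAct, Pi.mul_apply, mul_inv_rev, mul_assoc]

/-- A gauge transformation of an `S`-valued field by an `S`-valued `u` is `S`-valued. [folklore] -/
theorem gaugeAct_mem_of {S : Subgroup G} {V : Site d → Fin d → G} (hV : ∀ x κ, V x κ ∈ S) {u : Site d → G}
    (hu : ∀ x, u x ∈ S) (x : Site d) (κ : Fin d) : gaugeAct u V x κ ∈ S :=
  S.mul_mem (S.mul_mem (hu x) (hV x κ)) (S.inv_mem (hu _))

/-- Gauge transformations respect agreement on the bonds of a box. [folklore] -/
theorem gaugeAct_agree {lo hi : Site d} {V V' : Site d → Fin d → G} (h : AgreeOn lo hi V V') (u : Site d → G) :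
    AgreeOn lo hi (gaugeAct u V) (gaugeAct u V') := fun x κ hx hx' => by
  simp only [gaugeAct, h x κ hx hx']

/-- `V(Γ_{y,y}) = 1` (empty contour). [folklore] -/
theorem axialFn_self (W : Site d → Fin d → G) (y : Site d) : axialFn W y y = 1 := by
  simp [axialFn]

/-- (8) of [3] for the tree contour: `V^{g}(Γ_{z,x}) = g(z) V(Γ_{z,x}) g(x)⁻¹`.
[cite: Balaban1985Averaging, (8) p.18] -/
theorem axialFn_gaugeAct (g : Site d → G) (W : Site d → Fin d → G) (z x : Site d) :
    axialFn (gaugeAct g W) z x = g z * axialFn W z x * (g x)⁻¹ := by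
  unfold axialFn
  rw [hol_gaugeAct, disp_treeWord, add_sub_cancel]

/-- (8) of [3] for `Γ_{y,z}`: `V^{g}(Γ_{y,z}) = g(y) V(Γ_{y,z}) g(z)⁻¹`. [cite: Balaban1985Averaging, (8) p.18] -/
theorem hol_treeWord_gaugeAct (g : Site d → G) (W : Site d → Fin d → G) (y z : Site d) :
    hol (gaugeAct g W) y (treeWord (z - y)) = g y * hol W y (treeWord (z - y)) * (g z)⁻¹ := by
  rw [hol_gaugeAct, disp_treeWord, add_sub_cancel]

/-- **THE TOWER GAUGE TRANSFORMATION** solving (1.15) with the global axial gauge of the top level at `y` (p. 78,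
p. 98), for a tower of configurations `W j` (`j` = level, `W k` the top), indexed by the DEPTH `n = k − j`:
depth `0` (level `k`): `u_k(x) = W_k(Γ_{y,x})` (the axial gauge of [3] p. 24); depth `n + 1` (level `j = k − n − 1`):
`u_j(x) = u_{j+1}(z)·W_j(Γ_{Lz,x})` for `x ∈ B(Lz)`, `z = fl L x`.
[cite: Balaban1985RegularSpaces, (1.15) p.78; p.98] -/
def tg (L : ℕ) (W : ℕ → Site d → Fin d → G) (k : ℕ) (y : Site d) : ℕ → Site d → G
  | 0 => axialFn (W k) y
  | n + 1 => fun x => tg L W k y n (fl L x) * axialFn (W (k - (n + 1))) ((L : ℤ) • fl L x) x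

/-- `tg_zero` — the top level is the axial gauge at `y`. [cite: Balaban1985RegularSpaces, p.98] -/
@[simp] theorem tg_zero (L : ℕ) (W : ℕ → Site d → Fin d → G) (k : ℕ) (y : Site d) :
    tg L W k y 0 = axialFn (W k) y := rfl

/-- `tg_succ` — the recursion `u_j(x) = u_{j+1}(z)·W_j(Γ_{Lz,x})`. [cite: Balaban1985RegularSpaces, (1.15) p.78] -/
theorem tg_succ (L : ℕ) (W : ℕ → Site d → Fin d → G) (k : ℕ) (y : Site d) (n : ℕ) (x : Site d) :
    tg L W k y (n + 1) x = tg L W k y n (fl L x) * axialFn (W (k - (n + 1))) ((L : ℤ) • fl L x) x := rfl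

/-- CONSISTENCY ACROSS LEVELS: `u_j(Lz) = u_{j+1}(z)` (the block corner carries the coarse value). [folklore] -/
theorem tg_succ_smul {L : ℕ} (hL : 1 ≤ L) (W : ℕ → Site d → Fin d → G) (k : ℕ) (y : Site d) (n : ℕ)
    (z : Site d) : tg L W k y (n + 1) ((L : ℤ) • z) = tg L W k y n z := by
  rw [tg_succ, fl_smul hL, axialFn_self, mul_one]

/-- The recursion at a block point `x = Lz + r`. [folklore] -/
theorem tg_succ_block {L : ℕ} (hL : 1 ≤ L) (W : ℕ → Site d → Fin d → G) (k : ℕ) (y : Site d) (n : ℕ)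
    (z : Site d) (r : Fin d → Fin L) :
    tg L W k y (n + 1) ((L : ℤ) • z + boxVec L r) =
      tg L W k y n z * axialFn (W (k - (n + 1))) ((L : ℤ) • z) ((L : ℤ) • z + boxVec L r) := by
  rw [tg_succ, fl_block hL]

/-- CONSISTENCY, iterated: `u_{m}`-values are the `u_{m+j}`-values at `Lʲ`-multiples. [folklore] -/
theorem tg_add_pow_smul {L : ℕ} (hL : 1 ≤ L) (W : ℕ → Site d → Fin d → G) (k : ℕ) (y : Site d) (m : ℕ) :
    ∀ (j : ℕ) (x : Site d), tg L W k y (m + j) (((L : ℤ) ^ j) • x) = tg L W k y m x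
  | 0, x => by simp
  | j + 1, x => by
    rw [pow_succ', mul_smul, ← add_assoc, tg_succ_smul hL, tg_add_pow_smul hL W k y m j x]

/-- NORMALISATION: `u(Lᵏy) = u_k(y) = W_k(Γ_{y,y}) = 1` — the tower gauge transformation is `1` at the fine site
under the top center (print's (1.14) `u(y) = 1`). [cite: Balaban1985RegularSpaces, (1.14) p.78] -/
theorem tg_top {L : ℕ} (hL : 1 ≤ L) (W : ℕ → Site d → Fin d → G) (k : ℕ) (y : Site d) :
    tg L W k y k (((L : ℤ) ^ k) • y) = 1 := by
  have h := tg_add_pow_smul hL W k y 0 k y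
  rw [zero_add] at h
  rw [h, tg_zero, axialFn_self]

/-- The tower gauge transformation of an `S`-valued tower is `S`-valued. [folklore] -/
theorem tg_mem {S : Subgroup G} {L : ℕ} {W : ℕ → Site d → Fin d → G} {k : ℕ}
    (hW : ∀ j ≤ k, ∀ x κ, W j x κ ∈ S) (y : Site d) : ∀ (n : ℕ) (x : Site d), tg L W k y n x ∈ S
  | 0, x => hol_mem_of (hW k le_rfl) _ _
  | n + 1, x => S.mul_mem (tg_mem hW y n _) (hol_mem_of (hW (k - (n + 1)) (by omega)) _ _)

/-- **(1.15) FROM THE COVARIANCE**: if the levels of the transformed tower are the gauge transforms `W′_j =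
(W_j)^{u∘(Lʲ·)}` of the levels of the original tower by the traces of the tower gauge transformation `u = tg … k`
(p. 78 "`(Ū^{uj})_b = (Ūʲ)ᵘ_b`"), then `W′_j(Γ_{Lz,x}) = 1` for every `x ∈ B(Lz)`, `z` in the `(j+1)`-lattice,
`j < k` — the telescoping `u_j(Lz)·W_j(Γ_{Lz,x})·u_j(x)⁻¹ = u_{j+1}(z)W_j(Γ_{Lz,x})(u_{j+1}(z)W_j(Γ_{Lz,x}))⁻¹ = 1`.
[cite: Balaban1985RegularSpaces, (1.15) p.78] -/
theorem h15_of_cov {L : ℕ} (hL : 1 ≤ L) (W W' : ℕ → Site d → Fin d → G) (k : ℕ) (y : Site d)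
    (hcov : ∀ j ≤ k, W' j = gaugeAct (uLev L (tg L W k y k) j) (W j))
    (n : ℕ) (hn : n < k) (z : Site d) (r : Fin d → Fin L) :
    axialFn (W' (k - (n + 1))) ((L : ℤ) • z) ((L : ℤ) • z + boxVec L r) = 1 := by
  have hu : ∀ x, tg L W k y k (((L : ℤ) ^ (k - (n + 1))) • x) = tg L W k y (n + 1) x := fun x => by
    have h := tg_add_pow_smul hL W k y (n + 1) (k - (n + 1)) x
    have hkj : n + 1 + (k - (n + 1)) = k := by omega
    rwa [hkj] at h
  rw [hcov (k - (n + 1)) (by omega)]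
  simp only [axialFn_gaugeAct, uLev_apply, hu]
  rw [tg_succ_smul hL, tg_succ_block hL]
  exact mul_inv_cancel _

/-- **THE GLOBAL AXIAL GAUGE OF THE TOP LEVEL FROM THE COVARIANCE**: `W′_k(Γ_{y,z}) = u_k(y)W_k(Γ_{y,z})u_k(z)⁻¹ =
1` since `u_k = W_k(Γ_{y,·})` ([3] p. 24 "`V₀ = V^{v₀}` satisfies the conditions `V₀(Γ_{y,x}) = 1`").
[cite: Balaban1985RegularSpaces, p.98; Balaban1985Averaging, p.24] -/
theorem top_of_cov {L : ℕ} (hL : 1 ≤ L) (W W' : ℕ → Site d → Fin d → G) (k : ℕ) (y : Site d)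
    (hcov : W' k = gaugeAct (uLev L (tg L W k y k) k) (W k)) (z : Site d) :
    hol (W' k) y (treeWord (z - y)) = 1 := by
  have hu : ∀ x, tg L W k y k (((L : ℤ) ^ k) • x) = axialFn (W k) y x := fun x => by
    have h := tg_add_pow_smul hL W k y 0 k x
    rw [zero_add] at h
    exact h
  rw [hcov, hol_treeWord_gaugeAct]
  simp only [uLev_apply, hu, axialFn_self, one_mul]
  exact mul_inv_cancel _

/-- **UNIQUENESS UP TO A CONSTANT (algebraic core)**: if the levels of a second tower are the gauge transforms of
the levels of a first one by the traces `w ∘ (Lʲ·)` of ONE fine-lattice transformation `w` (p. 78 covariance), and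
BOTH towers satisfy (1.15) at all levels and the global axial gauge of the top level at `y`, then `w` is constant
(`= w(Lᵏy)`): top level — `w_k(y)·1·w_k(z)⁻¹ = 1`; descending — `w_j(Lz)·1·w_j(x)⁻¹ = 1` on each block.
[cite: Balaban1985RegularSpaces, p.78 ("determine uniquely an element in each orbit")] -/
theorem const_of_cov {L : ℕ} (hL : 1 ≤ L) (W₁ W₂ : ℕ → Site d → Fin d → G) (k : ℕ) (y : Site d)
    (w : Site d → G) (hcov : ∀ j ≤ k, W₂ j = gaugeAct (uLev L w j) (W₁ j))
    (h15₁ : ∀ n, n < k → ∀ (z : Site d) (r : Fin d → Fin L),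
      axialFn (W₁ (k - (n + 1))) ((L : ℤ) • z) ((L : ℤ) • z + boxVec L r) = 1)
    (h15₂ : ∀ n, n < k → ∀ (z : Site d) (r : Fin d → Fin L),
      axialFn (W₂ (k - (n + 1))) ((L : ℤ) • z) ((L : ℤ) • z + boxVec L r) = 1)
    (htop₁ : ∀ z, hol (W₁ k) y (treeWord (z - y)) = 1)
    (htop₂ : ∀ z, hol (W₂ k) y (treeWord (z - y)) = 1) :
    ∀ x, w x = w (((L : ℤ) ^ k) • y) := by
  suffices H : ∀ n ≤ k, ∀ x, w (((L : ℤ) ^ (k - n)) • x) = w (((L : ℤ) ^ k) • y) by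
    intro x
    simpa using H k le_rfl x
  intro n
  induction n with
  | zero =>
    intro _ x
    have h := htop₂ x
    rw [hcov k le_rfl, hol_treeWord_gaugeAct, uLev_apply, uLev_apply, htop₁ x, mul_one, mul_inv_eq_one] at h
    rw [Nat.sub_zero]
    exact h.symm
  | succ n ih =>
    intro hn x
    obtain ⟨r, hx⟩ := exists_block hL x
    have h := h15₂ n (by omega) (fl L x) r
    rw [hcov (k - (n + 1)) (by omega)] at h
    simp only [axialFn_gaugeAct, uLev_apply, h15₁ n (by omega) (fl L x) r, mul_one, mul_inv_eq_one] at h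
    rw [← hx] at h
    rw [← h, smul_smul, ← pow_succ, show k - (n + 1) + 1 = k - n by omega]
    exact ih (by omega) (fl L x)

end Algebra

/-! ## §3 The tree's covariance of the tower of averages (43) (p. 78 = (11)/(45) of [3]) — pointers

p. 78 "`(Ū^{u j})_b = (Ūʲ)ᵘ_b = u(b₋)(Ūʲ)_b u⁻¹(b₊)` for `b ⊂ T^{(j)}`" is, on the `ℤ^d` tower, the tree theorem
`B7AvgGaugeCovariance.avgIter_gaugeAct` (`\overline{(U^u)}^j = (Ūʲ)^{u_j}`, `u_j = uLev L u j = u ∘ (Lʲ·)`, under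
(1.7) with the Prop. 1/2 smallness of [3] — the `log` of (43) taken inside its domain, `Wcx_avgIter_lt_one`), and
the gauge invariance of (1.7) is `B7AvgGaugeCovariance.pdev_gaugeAct`; both are used BY NAME (with `α₀L²` for their
`α₀`).  Only the version of the latter for the plaquettes of a box is added here. -/

section Analytic

variable {𝔸 : Type*} [NormedRing 𝔸] [NormOneClass 𝔸]

/-- (1.7) on the plaquettes of a box is gauge invariant (`|u V(∂p) u⁻¹ − 1| = |V(∂p) − 1|`, (45) of [3]; the tree's
`norm_hol_gaugeAct_plaqWord` under the supremum over the box). [cite: Balaban1985Averaging, (45) p.24] -/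
theorem pdevOn_gaugeAct {u : Site d → 𝔸ˣ} (hu : ∀ x, u x ∈ U1 𝔸) (lo hi : Site d) (V : Site d → Fin d → 𝔸ˣ) :
    pdevOn lo hi (gaugeAct u V) = pdevOn lo hi V := by
  unfold pdevOn
  exact iSup_congr fun p => norm_hol_gaugeAct_plaqWord hu V p.1.1 p.1.2.1 p.1.2.2

variable [NormedAlgebra ℂ 𝔸] [CompleteSpace 𝔸]

/-! ## §4 Existence and uniqueness of the gauge (p. 78 "determine uniquely an element in each orbit", p. 98) -/

/-- The gauge transformation of p. 98 on the fine lattice for the tower `Ūʲ = avgIter L U j`, `j ≤ k`, with top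
center `y`: `towerGauge L U k y = tg L (avgIter L U) k y k`. [cite: Balaban1985RegularSpaces, p.98, (1.15) p.78] -/
abbrev towerGauge (L : ℕ) (U : Site d → Fin d → 𝔸ˣ) (k : ℕ) (y : Site d) : Site d → 𝔸ˣ :=
  tg L (avgIter L U) k y k

omit [NormOneClass 𝔸] in
/-- NORMALISATION (print's (1.14) at the top center): `u(Lᵏy) = 1` for `u = towerGauge L U k y`.
[cite: Balaban1985RegularSpaces, (1.14) p.78] -/
theorem towerGauge_top {L : ℕ} (hL : 1 ≤ L) (U : Site d → Fin d → 𝔸ˣ) (k : ℕ) (y : Site d) :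
    towerGauge L U k y (((L : ℤ) ^ k) • y) = 1 :=
  tg_top hL (avgIter L U) k y

/-- **EXISTENCE OF THE GAUGE (p. 78 (1.15) + p. 98), GLOBAL CARRIER.** Let `G` be an `AvgClosed` gauge group,
`L ≥ 2`, `U` `G`-valued with (1.7) `sup_p |U(∂p) − 1| < α₀L²·L^{−2k}` and `α₀L²` Prop.-1/2-small.  Then for
`u := towerGauge L U k y` and `U′ := U^{u}`: `u` and `U′` are `G`-valued; `sup_p |U′(∂p) − 1| = sup_p |U(∂p) − 1|`;
for every `j ≤ k`, `Ū′ʲ = (Ūʲ)^{u∘(Lʲ·)}` (p. 78); (1.15) holds for `U′` between all consecutive levels: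
`Ū′ʲ(Γ_{Lz,x}) = 1`, `x ∈ B(Lz)`, all `z`, `j < k`; and the top level is in the global axial gauge at `y`:
`Ū′ᵏ(Γ_{y,z}) = 1` for all `z`. [cite: Balaban1985RegularSpaces, (1.15) p.78, p.98] -/
theorem gaugeFix_global (L : ℕ) (hL : 2 ≤ L) {G : Subgroup 𝔸ˣ} (hG : AvgClosed d L G) (k : ℕ)
    (U : Site d → Fin d → 𝔸ˣ) (hU : ∀ x κ, U x κ ∈ G) {α₀ : ℝ} (hα : 0 < α₀)
    (hα3 : C0 d * (α₀ * (L : ℝ) ^ 2) ≤ 1 / 3) (hα2 : 2 * (α₀ * (L : ℝ) ^ 2) ≤ c2' d L)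
    (h17 : pdev U < α₀ * (L : ℝ) ^ 2 * (((L : ℝ) ^ k)⁻¹) ^ 2) (y : Site d) :
    (∀ x, towerGauge L U k y x ∈ G) ∧
    (∀ x κ, gaugeAct (towerGauge L U k y) U x κ ∈ G) ∧
    pdev (gaugeAct (towerGauge L U k y) U) = pdev U ∧
    (∀ j ≤ k, avgIter L (gaugeAct (towerGauge L U k y) U) j =
      gaugeAct (uLev L (towerGauge L U k y) j) (avgIter L U j)) ∧
    (∀ n, n < k → ∀ (z : Site d) (r : Fin d → Fin L),
      axialFn (avgIter L (gaugeAct (towerGauge L U k y) U) (k - (n + 1))) ((L : ℤ) • z)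
        ((L : ℤ) • z + boxVec L r) = 1) ∧
    (∀ z, hol (avgIter L (gaugeAct (towerGauge L U k y) U) k) y (treeWord (z - y)) = 1) := by
  have hL1 : 1 ≤ L := le_trans (by norm_num) hL
  have hα' : 0 < α₀ * (L : ℝ) ^ 2 := by positivity
  have hmemG : ∀ j ≤ k, ∀ x μ, avgIter L U j x μ ∈ G := avgIter_mem L hL hG k U hU hα' hα3 hα2 h17
  have huG : ∀ x, towerGauge L U k y x ∈ G := fun x => tg_mem hmemG y k x
  have huU : ∀ x, towerGauge L U k y x ∈ U1 𝔸 := fun x => hG.le_U1 (huG x)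
  have hcov : ∀ j ≤ k, avgIter L (gaugeAct (towerGauge L U k y) U) j =
      gaugeAct (uLev L (towerGauge L U k y) j) (avgIter L U j) :=
    avgIter_gaugeAct L hL hG k U hU huU hα' hα3 hα2 h17
  exact ⟨huG, fun x κ => gaugeAct_mem_of hU huG x κ, pdev_gaugeAct huU U, hcov,
    fun n hn z r => h15_of_cov hL1 (avgIter L U) (avgIter L (gaugeAct (towerGauge L U k y) U)) k y hcov n hn z r,
    fun z => top_of_cov hL1 (avgIter L U) (avgIter L (gaugeAct (towerGauge L U k y) U)) k y (hcov k le_rfl) z⟩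

/-- **UNIQUENESS OF THE GAUGE UP TO A CONSTANT (p. 78 "these equations … determine uniquely an element in each
orbit").**  Under the hypotheses of `gaugeFix_global`, if two `G`-valued gauge transformations `u₁`, `u₂` both
bring `U` to a configuration satisfying (1.15) between all consecutive levels and the global axial gauge of the top
level at `y`, then `u₂(x) = u₂(Lᵏy)u₁(Lᵏy)⁻¹·u₁(x)` for all `x` (so `U^{u₂}` is the conjugate of `U^{u₁}` by the
constant `u₂(Lᵏy)u₁(Lᵏy)⁻¹`; print's normalisation (1.14) makes the constant `1`).
[cite: Balaban1985RegularSpaces, p.78] -/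
theorem gaugeFix_unique (L : ℕ) (hL : 2 ≤ L) {G : Subgroup 𝔸ˣ} (hG : AvgClosed d L G) (k : ℕ)
    (U : Site d → Fin d → 𝔸ˣ) (hU : ∀ x κ, U x κ ∈ G) {α₀ : ℝ} (hα : 0 < α₀)
    (hα3 : C0 d * (α₀ * (L : ℝ) ^ 2) ≤ 1 / 3) (hα2 : 2 * (α₀ * (L : ℝ) ^ 2) ≤ c2' d L)
    (h17 : pdev U < α₀ * (L : ℝ) ^ 2 * (((L : ℝ) ^ k)⁻¹) ^ 2) (y : Site d)
    (u₁ u₂ : Site d → 𝔸ˣ) (hu₁ : ∀ x, u₁ x ∈ G) (hu₂ : ∀ x, u₂ x ∈ G)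
    (h15₁ : ∀ n, n < k → ∀ (z : Site d) (r : Fin d → Fin L),
      axialFn (avgIter L (gaugeAct u₁ U) (k - (n + 1))) ((L : ℤ) • z) ((L : ℤ) • z + boxVec L r) = 1)
    (h15₂ : ∀ n, n < k → ∀ (z : Site d) (r : Fin d → Fin L),
      axialFn (avgIter L (gaugeAct u₂ U) (k - (n + 1))) ((L : ℤ) • z) ((L : ℤ) • z + boxVec L r) = 1)
    (htop₁ : ∀ z, hol (avgIter L (gaugeAct u₁ U) k) y (treeWord (z - y)) = 1)
    (htop₂ : ∀ z, hol (avgIter L (gaugeAct u₂ U) k) y (treeWord (z - y)) = 1) :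
    ∀ x, u₂ x = u₂ (((L : ℤ) ^ k) • y) * (u₁ (((L : ℤ) ^ k) • y))⁻¹ * u₁ x := by
  set w : Site d → 𝔸ˣ := fun x => u₂ x * (u₁ x)⁻¹ with hw
  have hwU : ∀ x, w x ∈ U1 𝔸 := fun x =>
    (U1 𝔸).mul_mem (hG.le_U1 (hu₂ x)) ((U1 𝔸).inv_mem (hG.le_U1 (hu₁ x)))
  have hU₁ : ∀ x κ, gaugeAct u₁ U x κ ∈ G := gaugeAct_mem_of hU hu₁
  have h17₁ : pdev (gaugeAct u₁ U) < α₀ * (L : ℝ) ^ 2 * (((L : ℝ) ^ k)⁻¹) ^ 2 := by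
    rw [pdev_gaugeAct (fun x => hG.le_U1 (hu₁ x))]; exact h17
  have hmul : gaugeAct u₂ U = gaugeAct w (gaugeAct u₁ U) := by
    rw [← gaugeAct_mul]
    congr 1
    funext x
    simp [hw]
  have hα' : 0 < α₀ * (L : ℝ) ^ 2 := by positivity
  have hcov : ∀ j ≤ k, avgIter L (gaugeAct u₂ U) j = gaugeAct (uLev L w j) (avgIter L (gaugeAct u₁ U) j) := by
    rw [hmul]
    exact avgIter_gaugeAct L hL hG k _ hU₁ hwU hα' hα3 hα2 h17₁
  have hL1 : 1 ≤ L := le_trans (by norm_num) hL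
  intro x
  have hc := const_of_cov hL1 (avgIter L (gaugeAct u₁ U)) (avgIter L (gaugeAct u₂ U)) k y w hcov
    h15₁ h15₂ htop₁ htop₂ x
  simp only [hw] at hc
  calc u₂ x = u₂ x * (u₁ x)⁻¹ * u₁ x := by rw [inv_mul_cancel_right]
    _ = u₂ (((L : ℤ) ^ k) • y) * (u₁ (((L : ℤ) ^ k) • y))⁻¹ * u₁ x := by rw [hc]

/-- **CONSTANTS ACT** (the converse of `gaugeFix_unique`): if `u` brings `U` to (1.15) between all consecutive
levels and to the global axial gauge of the top level at `y`, then so does `c·u` for every constant `c ∈ G`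
(`Ū^{cu,j} = c Ū^{u,j} c⁻¹` by the covariance p. 78, and `c·1·c⁻¹ = 1`).  Hence the solutions of (1.15) + top
axial gauge in the orbit of `U` are EXACTLY the constant multiples of `towerGauge L U k y`
(`gaugeFix_global`, `gaugeFix_unique`). [cite: Balaban1985RegularSpaces, p.78] -/
theorem gaugeFix_const_mul (L : ℕ) (hL : 2 ≤ L) {G : Subgroup 𝔸ˣ} (hG : AvgClosed d L G) (k : ℕ)
    (U : Site d → Fin d → 𝔸ˣ) (hU : ∀ x κ, U x κ ∈ G) {α₀ : ℝ} (hα : 0 < α₀)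
    (hα3 : C0 d * (α₀ * (L : ℝ) ^ 2) ≤ 1 / 3) (hα2 : 2 * (α₀ * (L : ℝ) ^ 2) ≤ c2' d L)
    (h17 : pdev U < α₀ * (L : ℝ) ^ 2 * (((L : ℝ) ^ k)⁻¹) ^ 2) (y : Site d)
    (u : Site d → 𝔸ˣ) (hu : ∀ x, u x ∈ G) {c : 𝔸ˣ} (hc : c ∈ G)
    (h15 : ∀ n, n < k → ∀ (z : Site d) (r : Fin d → Fin L),
      axialFn (avgIter L (gaugeAct u U) (k - (n + 1))) ((L : ℤ) • z) ((L : ℤ) • z + boxVec L r) = 1)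
    (htop : ∀ z, hol (avgIter L (gaugeAct u U) k) y (treeWord (z - y)) = 1) :
    (∀ n, n < k → ∀ (z : Site d) (r : Fin d → Fin L),
      axialFn (avgIter L (gaugeAct (fun x => c * u x) U) (k - (n + 1))) ((L : ℤ) • z)
        ((L : ℤ) • z + boxVec L r) = 1) ∧
    (∀ z, hol (avgIter L (gaugeAct (fun x => c * u x) U) k) y (treeWord (z - y)) = 1) := by
  have hU₁ : ∀ x κ, gaugeAct u U x κ ∈ G := gaugeAct_mem_of hU hu
  have h17₁ : pdev (gaugeAct u U) < α₀ * (L : ℝ) ^ 2 * (((L : ℝ) ^ k)⁻¹) ^ 2 := by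
    rw [pdev_gaugeAct (fun x => hG.le_U1 (hu x))]; exact h17
  have hcU : ∀ x : Site d, (fun _ : Site d => c) x ∈ U1 𝔸 := fun _ => hG.le_U1 hc
  have hmul : gaugeAct (fun x => c * u x) U = gaugeAct (fun _ => c) (gaugeAct u U) := by
    rw [← gaugeAct_mul]; rfl
  have hα' : 0 < α₀ * (L : ℝ) ^ 2 := by positivity
  have hcov : ∀ j ≤ k, avgIter L (gaugeAct (fun x => c * u x) U) j =
      gaugeAct (uLev L (fun _ => c) j) (avgIter L (gaugeAct u U) j) := by
    rw [hmul]
    exact avgIter_gaugeAct L hL hG k _ hU₁ hcU hα' hα3 hα2 h17₁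
  refine ⟨fun n hn z r => ?_, fun z => ?_⟩
  · rw [hcov _ (by omega)]
    simp only [axialFn_gaugeAct, uLev_apply, h15 n hn z r, mul_one, mul_inv_cancel]
  · rw [hcov k le_rfl]
    simp only [hol_treeWord_gaugeAct, uLev_apply, htop z, mul_one, mul_inv_cancel]

/-- **EXACT UNIQUENESS UNDER THE NORMALISATION `u(Lᵏy) = 1`** (print: (1.15) "together with (1.14) for gauge
transformations determine uniquely an element in each orbit"): a `G`-valued `u` with `u(Lᵏy) = 1` bringing `U` to
(1.15) between all consecutive levels and to the global axial gauge of the top level at `y` IS `towerGauge L U k y`.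
[cite: Balaban1985RegularSpaces, (1.14)–(1.15) p.78] -/
theorem gaugeFix_unique_normalised (L : ℕ) (hL : 2 ≤ L) {G : Subgroup 𝔸ˣ} (hG : AvgClosed d L G) (k : ℕ)
    (U : Site d → Fin d → 𝔸ˣ) (hU : ∀ x κ, U x κ ∈ G) {α₀ : ℝ} (hα : 0 < α₀)
    (hα3 : C0 d * (α₀ * (L : ℝ) ^ 2) ≤ 1 / 3) (hα2 : 2 * (α₀ * (L : ℝ) ^ 2) ≤ c2' d L)
    (h17 : pdev U < α₀ * (L : ℝ) ^ 2 * (((L : ℝ) ^ k)⁻¹) ^ 2) (y : Site d)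
    (u : Site d → 𝔸ˣ) (hu : ∀ x, u x ∈ G) (hnorm : u (((L : ℤ) ^ k) • y) = 1)
    (h15 : ∀ n, n < k → ∀ (z : Site d) (r : Fin d → Fin L),
      axialFn (avgIter L (gaugeAct u U) (k - (n + 1))) ((L : ℤ) • z) ((L : ℤ) • z + boxVec L r) = 1)
    (htop : ∀ z, hol (avgIter L (gaugeAct u U) k) y (treeWord (z - y)) = 1) :
    u = towerGauge L U k y := by
  have hL1 : 1 ≤ L := le_trans (by norm_num) hL
  obtain ⟨huG, -, -, -, h15₁, htop₁⟩ := gaugeFix_global L hL hG k U hU hα hα3 hα2 h17 y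
  funext x
  have h := gaugeFix_unique L hL hG k U hU hα hα3 hα2 h17 y (towerGauge L U k y) u huG hu h15₁ h15 htop₁ htop x
  rw [hnorm, towerGauge_top hL1, inv_one, one_mul, one_mul] at h
  exact h

/-! ## §5 (1.130) for every orbit: the hypotheses (1.15) / global axial gauge of `B8Ineq130` discharged -/

/-- **(1.130), FIRST MEMBER, GLOBAL CARRIER, FOR EVERY ORBIT**: for every `G`-valued `U₀` with (1.7) on
`Ω_{k−1}` (global form `sup_p |U₀(∂p) − 1| < α₀L²·L^{−2k}`) and the explicit smallness of `B8Ineq130`, the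
gauge-fixed configuration `U₀′ := U₀^{u}`, `u = towerGauge L U₀ k y` (p. 98), satisfies
`|Ū₀′^{k−n}(x, x + e_ν) − 1| ≤ 8d²L²(Σ_{m<n}L^{−2m})α₀ + (M + 4R₁M₁)dL²α₀` on every bond of `□̃^{(k−n)}`, `n ≤ k`
— `B8Ineq130.ineq130_global` with its gauge hypotheses supplied by `gaugeFix_global`.
[cite: Balaban1985RegularSpaces, (1.130) p.99, p.98, (1.15) p.78] -/
theorem ineq130_global_fixed (L : ℕ) (hL : 2 ≤ L) (hd : 1 ≤ d) {G : Subgroup 𝔸ˣ} (hG : AvgClosed d L G)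
    (k : ℕ) (U : Site d → Fin d → 𝔸ˣ) (hU : ∀ x κ, U x κ ∈ G) {α₀ : ℝ} (hα : 0 < α₀)
    (hα3 : C0 d * (α₀ * (L : ℝ) ^ 2) ≤ 1 / 3) (hα2 : 2 * (α₀ * (L : ℝ) ^ 2) ≤ c2' d L)
    (h17 : pdev U < α₀ * (L : ℝ) ^ 2 * (((L : ℝ) ^ k)⁻¹) ^ 2) (lo hi : Site d)
    {y : Site d} {h : ℕ} (hy : lo ≤ y) (hy' : y ≤ hi) (hrad : ∀ κ, y κ - lo κ ≤ h ∧ hi κ - y κ ≤ h)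
    {M R₁ M₁ : ℝ} (hside : 2 * (h : ℝ) ≤ M + 4 * R₁ * M₁)
    (hsmall : 11 * (d : ℝ) ^ 2 * (L : ℝ) ^ 2 * α₀ + (M + 4 * R₁ * M₁) * d * (L : ℝ) ^ 2 * α₀ ≤ 1 / 6)
    (n : ℕ) (hn : n ≤ k) (x : Site d) (ν : Fin d) (hx : tlo L lo n ≤ x) (hxν : x + e ν ≤ thi L hi n) :
    ‖((avgIter L (gaugeAct (towerGauge L U k y) U) (k - n) x ν : 𝔸ˣ) : 𝔸) - 1‖ ≤
      bound130 d L α₀ M R₁ M₁ n := by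
  obtain ⟨-, hU', hpd, -, h15, hgax⟩ := gaugeFix_global L hL hG k U hU hα hα3 hα2 h17 y
  exact ineq130_global L hL hd hG k _ hU' hα hα3 hα2 (by rw [hpd]; exact h17) lo hi
    (fun n hn z _ _ r => h15 n hn z r) hy hy' hrad (fun z _ _ => hgax z) hside hsmall n hn x ν hx hxν

/-- The gauge transformation for the LOCAL carrier: the tower gauge of the clamped extension
(`B7Prop1Local.clampCfg`) of `U₀|□̃`, `□̃ = [tlo k, thi k]` on the finest level.
[cite: Balaban1985RegularSpaces, p.98] -/
abbrev localGauge (L : ℕ) (lo hi : Site d) (U : Site d → Fin d → 𝔸ˣ) (k : ℕ) (y : Site d) : Site d → 𝔸ˣ :=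
  towerGauge L (clampCfg (tlo L lo k) (thi L hi k) U) k y

/-- **(1.130), ALL THREE MEMBERS, LOCAL CARRIER, FOR EVERY ORBIT** — the printed setting of Sect. F in full: "Let
us consider the configuration `U₀` on the cube `□̃`. … We apply a gauge transformation to `U₀`, such that the gauge
transformed configuration `U₀′` satisfies the axial gauge conditions (1.15), and `Ū₀′ᵏ` satisfies the global axial
gauge conditions on `□̃^{(k)}` … Applying Lemma 1 many times … we get (1.130)".  HYPOTHESES: `G` `AvgClosed`,
`L ≥ 2`, `d ≥ 1`, `U₀` `G`-valued, (1.7) on the unit plaquettes of `□̃` ONLY (`pdevOn (tlo k) (thi k) U₀ <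
α₀L²·L^{−2k}`), the explicit smallness, `□̃^{(k)} = [lo, hi]` with center `y`, `|x − y|_∞ ≤ h`, `2h ≤ M + 4R₁M₁`,
`R₁M₁ ≤ M`, `11d < M`.  CONCLUSION, for `u := localGauge L lo hi U₀ k y` and `U₀′ := U₀^{u}`: `u` is `G`-valued;
`U₀′` satisfies (1.15) between consecutive levels on the tower of cubes and the global axial gauge of `Ū₀′ᵏ` on
`□̃^{(k)}` at `y`; and for every `n ≤ k` and bond `⟨x, x + e_ν⟩ ⊂ □̃^{(k−n)}`: `|Ū₀′^{k−n}(x, x + e_ν) − 1| ≤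
8d²L²(Σ_{m<n}L^{−2m})α₀ + (M + 4R₁M₁)dL²α₀ < 11d²L²α₀ + 5dL²Mα₀ < 6dL²Mα₀`.
[cite: Balaban1985RegularSpaces, (1.130) p.99, p.98, (1.15) p.78] -/
theorem ineq130_fixed (L : ℕ) (hL : 2 ≤ L) (hd : 1 ≤ d) {G : Subgroup 𝔸ˣ} (hG : AvgClosed d L G) (k : ℕ)
    (U : Site d → Fin d → 𝔸ˣ) (hU : ∀ x κ, U x κ ∈ G) {α₀ : ℝ} (hα : 0 < α₀)
    (hα3 : C0 d * (α₀ * (L : ℝ) ^ 2) ≤ 1 / 3) (hα2 : 2 * (α₀ * (L : ℝ) ^ 2) ≤ c2' d L)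
    (lo hi : Site d) (hlohi : lo ≤ hi)
    (h17 : pdevOn (tlo L lo k) (thi L hi k) U < α₀ * (L : ℝ) ^ 2 * (((L : ℝ) ^ k)⁻¹) ^ 2)
    {y : Site d} {h : ℕ} (hy : lo ≤ y) (hy' : y ≤ hi) (hrad : ∀ κ, y κ - lo κ ≤ h ∧ hi κ - y κ ≤ h)
    {M R₁ M₁ : ℝ} (hside : 2 * (h : ℝ) ≤ M + 4 * R₁ * M₁) (hRM : R₁ * M₁ ≤ M) (hM : 11 * (d : ℝ) < M)
    (hsmall : 11 * (d : ℝ) ^ 2 * (L : ℝ) ^ 2 * α₀ + (M + 4 * R₁ * M₁) * d * (L : ℝ) ^ 2 * α₀ ≤ 1 / 6) :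
    (∀ x, localGauge L lo hi U k y x ∈ G) ∧
    (∀ n, n < k → ∀ z, tlo L lo n ≤ z → z ≤ thi L hi n → ∀ r : Fin d → Fin L,
      axialFn (avgIter L (gaugeAct (localGauge L lo hi U k y) U) (k - (n + 1))) ((L : ℤ) • z)
        ((L : ℤ) • z + boxVec L r) = 1) ∧
    (∀ z, lo ≤ z → z ≤ hi →
      hol (avgIter L (gaugeAct (localGauge L lo hi U k y) U) k) y (treeWord (z - y)) = 1) ∧
    ∀ (n : ℕ), n ≤ k → ∀ (x : Site d) (ν : Fin d), tlo L lo n ≤ x → x + e ν ≤ thi L hi n →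
      ‖((avgIter L (gaugeAct (localGauge L lo hi U k y) U) (k - n) x ν : 𝔸ˣ) : 𝔸) - 1‖ ≤
          bound130 d L α₀ M R₁ M₁ n ∧
        bound130 d L α₀ M R₁ M₁ n < 11 * (d : ℝ) ^ 2 * (L : ℝ) ^ 2 * α₀ + 5 * d * (L : ℝ) ^ 2 * M * α₀ ∧
        11 * (d : ℝ) ^ 2 * (L : ℝ) ^ 2 * α₀ + 5 * d * (L : ℝ) ^ 2 * M * α₀ < 6 * d * (L : ℝ) ^ 2 * M * α₀ ∧
        ‖((avgIter L (gaugeAct (localGauge L lo hi U k y) U) (k - n) x ν : 𝔸ˣ) : 𝔸) - 1‖ <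
          6 * d * (L : ℝ) ^ 2 * M * α₀ := by
  have hL1 : 1 ≤ L := le_trans (by norm_num) hL
  have hUU : ∀ x κ, U x κ ∈ U1 𝔸 := fun x κ => hG.le_U1 (hU x κ)
  have hkk : ∀ i, tlo L lo k i ≤ thi L hi k i := tlo_le_thi hL1 hlohi k
  set Uc := clampCfg (tlo L lo k) (thi L hi k) U with hUc
  have hUcG : ∀ x κ, Uc x κ ∈ G := clampCfg_mem hU
  have h17c : pdev Uc < α₀ * (L : ℝ) ^ 2 * (((L : ℝ) ^ k)⁻¹) ^ 2 := (pdev_clampCfg_le hkk hUU).trans_lt h17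
  obtain ⟨huG, -, -, -, h15c, hgaxc⟩ := gaugeFix_global L hL hG k Uc hUcG hα hα3 hα2 h17c y
  have huU : ∀ x, localGauge L lo hi U k y x ∈ U1 𝔸 := fun x => hG.le_U1 (huG x)
  have hU' : ∀ x κ, gaugeAct (localGauge L lo hi U k y) U x κ ∈ G := gaugeAct_mem_of hU huG
  have hA : ∀ j m, m + j = k → AgreeOn (tlo L lo m) (thi L hi m)
      (avgIter L (gaugeAct (localGauge L lo hi U k y) Uc) j)
      (avgIter L (gaugeAct (localGauge L lo hi U k y) U) j) := fun j m hmj =>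
    agree_level hL1 j m (by rw [hmj]; exact gaugeAct_agree (clampCfg_agree U) _)
  have h15' : ∀ n, n < k → ∀ z, tlo L lo n ≤ z → z ≤ thi L hi n → ∀ r : Fin d → Fin L,
      axialFn (avgIter L (gaugeAct (localGauge L lo hi U k y) U) (k - (n + 1))) ((L : ℤ) • z)
        ((L : ℤ) • z + boxVec L r) = 1 := by
    intro n hn z hz hz' r
    obtain ⟨h1, h2⟩ := block_mem hz hz' r
    obtain ⟨h3, h4⟩ := smul_mem hL1 hz hz'
    rw [← axialFn_congr (hA (k - (n + 1)) (n + 1) (by omega)) _ _ (inBox_of_le h3 h4) (inBox_of_le h1 h2)]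
    exact h15c n hn z r
  have hgax' : ∀ z, lo ≤ z → z ≤ hi →
      hol (avgIter L (gaugeAct (localGauge L lo hi U k y) U) k) y (treeWord (z - y)) = 1 := by
    intro z hz hz'
    have hag := hA k 0 (by simp)
    rw [← hol_treeWord_congr hag y (z - y) (inBox_of_le hy hy')
      (by rw [add_sub_cancel]; exact inBox_of_le hz hz')]
    exact hgaxc z
  have h17' : pdevOn (tlo L lo k) (thi L hi k) (gaugeAct (localGauge L lo hi U k y) U) <
      α₀ * (L : ℝ) ^ 2 * (((L : ℝ) ^ k)⁻¹) ^ 2 := by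
    rw [pdevOn_gaugeAct huU]; exact h17
  exact ⟨huG, h15', hgax', fun n hn x ν hx hxν => ineq130 L hL hd hG k _ hU' hα hα3 hα2 lo hi hlohi h17' h15'
    hy hy' hrad hgax' hside hRM hM hsmall n hn x ν hx hxν⟩

end Analytic

end Literature.MathematicalPhysics.QuantumFieldTheory.Balaban1983to89.B8Eq115GaugeFixing
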